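import Summits.FinalStateConjecture.FinalStateConjecture.Theorems.ZeroEnergyKerrOrBombStationaryLimitReductionKerrSchildSlabs
import Summits.FinalStateConjecture.FinalStateConjecture.Theorems.ZeroEnergyKerrOrBombStationaryLimitReductionChartReadaptation
import Summits.FinalStateConjecture.FinalStateConjecture.Theorems.ZeroEnergyKerrOrBombStationaryLimitReductionKerrChartedOpenEmbedding
import HarnessLib

/-!
# Route ZeroEnergyKerrOrBomb · crux `StationaryLimitReduction` (stmt-FinalStateConjecture-10021), line
# `symplectic-dual-of-the-bomb` — the NEAR-ZONE CONVERGENCE CLAUSE of the chart transfer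
# `stub_chartTransfer`, closed

Helper file (`--supports stmt-FinalStateConjecture-10021`; registered helper `nearZone_transfer`) from
the lead's wave-1 stub-worker for `stub_chartTransfer` (lead prover-line-stmt-FinalStateConjecture-10021-a1-0,
2026-08-16). Assembles `boostedKerr_truncSlab_pullback_tendsto_zero` (`…KerrSchildSlabs.lean`: the
model-side transfer) with `truncDeviationCk_readapt_eq`, `contDiffOn_deviationExtend`,
`contDiffOn_boost_bilin` (`…ChartReadaptation.lean`: the identification): for a late chart
`ψ` of a stationary hole read in the adapted chart `A` moved by `(Λ, c₀)`, whose `Cᵏ` truncated slab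
deviations from the moved adapted background tend to `0` for every radius (the clause
`tendsto_truncDeviationCk` of a `StationaryFinalStateDecomposition`), and a `T`-equivariant Kerr
identification `Θ` of the hole in that chart (the clauses of `IsKerrCharted`: `|a| < M`, `c > 0`,
`r₀ < r₊`, `Θ` smooth on `{r > max r₀ 0}` with values in `A.domain`, equivariant, isometric on the
exterior), the RE-ADAPTED chart `ψ ∘ Φ̂`, `Φ = P ∘ Θ ∘ P⁻¹`, on the boosted Kerr exterior has `Cᵏ`
truncated slab deviations from `boostedKerrBackground Λ c₀ M a` tending to `0` for every radius — the
clause `tendsto_truncDeviationCk` of the target `FinalStateDecomposition` for that hole; and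
(`separation_transfer`) the separation clause `exists_pairwise_disjoint` of the target from the old one, via
the tube containment `conj_image_truncLateRegion_subset`; and (`isLateChart_conj`, via the generic
`isLateChart_readapt` and `conj_isOpenEmbedding`) the late-chart clause `isLateChart` of the target GIVEN the
tilt inclusion `t* ∘ P⁻¹ > τ₀' ⇒ x⁰ ∘ P⁻¹ ∘ Φ > τ₀` and the image clause — the two inputs the typed clauses of
`IsKerrCharted` do not supply (worker's report). No named fact, nothing restated. References: DHRT arXiv:2104.08222, §1; Dafermos–Luk arXiv:1710.01722, §1.2.1.
-/

-- every `Summit.FinalStateConjecture.FinalStateConjecture.…` name repeats the summit = sub-problem segment (D-0017 layout)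
set_option linter.dupNamespace false

noncomputable section

open scoped Topology ENNReal Manifold ContDiff
open Set Filter Function

namespace Summit.FinalStateConjecture.FinalStateConjecture.Theorems.SymplecticDualOfTheBomb

open Literature.Geometry.Lorentzian

/-- **Near-zone convergence of the re-adapted chart.** See the module docstring. [folklore] -/
theorem tendsto_truncDeviationCk_readapt (𝓢 : Spacetime.{0} 4) {𝓑 : StationaryAFBlackHole.{0}}
    (A : 𝓑.AdaptedChart) (Λ : lorentzGroup) (c₀ : E4) {M a c r₀ : ℝ} {Θ : E4 → E4} {k : ℕ}
    {ψ : (A.background.boost Λ c₀).domain → 𝓢.carrier} (hψ : ContMDiff 𝓘(ℝ, E4) (𝓡 4) ∞ ψ)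
    (hsub : Kerr.IsSubextremal M a) (hc : 0 < c) (hr₀ : r₀ < Kerr.rPlus M a)
    (hΘs : ContDiffOn ℝ ∞ Θ (Kerr.region a r₀ : Set E4))
    (hΘm : MapsTo Θ (Kerr.region a r₀ : Set E4) (A.domain : Set E4))
    (hΘe : ∀ x ∈ (Kerr.region a r₀ : Set E4), ∀ s : ℝ,
      Θ (x + s • E4.basisVector 0) = Θ x + (c * s) • E4.basisVector 0)
    (hiso : ∀ z ∈ (Kerr.exterior M a : Set E4), ∀ v w : E4,
      A.bilin (Θ z) (fderiv ℝ Θ z v) (fderiv ℝ Θ z w) = Kerr.bilin M a z v w)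
    (hmaps : MapsTo (fun x ↦ (Λ : E4 ≃L[ℝ] E4) (Θ (poincareInv Λ c₀ x)) + c₀)
      ((boostedKerrBackground Λ c₀ M a).domain : Set E4) ((A.background.boost Λ c₀).domain : Set E4))
    (hdev : ∀ Rt : ℝ, Tendsto (fun σ ↦ 𝓢.truncDeviationCk (A.background.boost Λ c₀) ψ k Rt σ) atTop (𝓝 0))
    (R : ℝ) :
    Tendsto (fun τ ↦ 𝓢.truncDeviationCk (boostedKerrBackground Λ c₀ M a)
      (fun y ↦ ψ ⟨(Λ : E4 ≃L[ℝ] E4) (Θ (poincareInv Λ c₀ y.1)) + c₀, hmaps y.2⟩) k R τ) atTop (𝓝 0) := by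
  have hψd : MDifferentiable 𝓘(ℝ, E4) (𝓡 4) ψ := hψ.mdifferentiable (by simp)
  have hB : ContDiffOn ℝ k (𝓢.deviationExtend (A.background.boost Λ c₀) ψ)
      (poincareInv Λ c₀ ⁻¹' (A.domain : Set E4)) :=
    ((contDiffOn_deviationExtend 𝓢 _ hψ (contDiffOn_boost_bilin A Λ c₀)).of_le
      (by exact_mod_cast le_top))
  have key := tendsto_supCkENorm_boostedKerr_truncTimeSlab A Λ c₀
    (hsub.pos.trans_le (le_add_of_nonneg_right (Real.sqrt_nonneg _))) hr₀ hc
    (hΘs.of_le (by exact_mod_cast le_top)) hΘm hΘe hB (fun Rt ↦ hdev Rt) R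
  refine key.congr fun τ ↦ ?_
  exact (truncDeviationCk_readapt_eq 𝓢 A Λ c₀ hψd hr₀.le hΘs hΘm hiso hmaps k R τ).symm

/-! ## Separation of the re-adapted near zones -/

/-- A subset of a subtype is recovered from the image of its values. [folklore] -/
theorem mem_of_val_mem_image {α : Type*} {p : α → Prop} {S : Set (Subtype p)} {y : Subtype p}
    (h : y.1 ∈ Subtype.val '' S) : y ∈ S := by
  obtain ⟨y', hy', hyy⟩ := h
  rwa [← Subtype.ext hyy]

/-- **Separation transfers.** For a stationary final-state decomposition `d` whose holes carry
`T`-equivariant Kerr identifications `Θᵢ` (the clauses of `IsKerrCharted` used: `|aᵢ| < Mᵢ`, `cᵢ > 0`,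
`r₀ᵢ < r₊`, `Θᵢ` continuous on `{r > max r₀ᵢ 0}` with values in `Aᵢ.domain`, equivariant), and every
radius `R`, there is a chart time `τ₁` after which the images under the OLD charts of the `Φᵢ`-images of
the boosted Kerr–Schild truncated world-tubes `{t*ᵢ > τ₁, rᵢ ≤ R}` — i.e. the truncated world-tubes of the
RE-ADAPTED charts `ψᵢ ∘ Φ̂ᵢ` — are pairwise disjoint: they lie in the old truncated tubes
(`conj_image_truncLateRegion_subset`), which separate (`exists_pairwise_disjoint`). [folklore] -/
theorem separation_transfer {𝓢 : Spacetime.{0} 4} {O : Set 𝓢.carrier} {k : ℕ}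
    (d : StationaryFinalStateDecomposition 𝓢 O k) (M a c r₀ : Fin d.N → ℝ) (Θ : Fin d.N → E4 → E4)
    (hsub : ∀ i, Kerr.IsSubextremal (M i) (a i)) (hc : ∀ i, 0 < c i)
    (hr₀ : ∀ i, r₀ i < Kerr.rPlus (M i) (a i))
    (hΘc : ∀ i, ContinuousOn (Θ i) (Kerr.region (a i) (r₀ i) : Set E4))
    (hΘm : ∀ i, MapsTo (Θ i) (Kerr.region (a i) (r₀ i) : Set E4) ((d.adapted i).domain : Set E4))
    (hΘe : ∀ i, ∀ x ∈ (Kerr.region (a i) (r₀ i) : Set E4), ∀ s : ℝ,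
      Θ i (x + s • E4.basisVector 0) = Θ i x + (c i * s) • E4.basisVector 0)
    (R : ℝ) :
    ∃ τ₁ : ℝ, Pairwise (Function.onFun Disjoint fun i ↦ d.toOver.chart i ''
      {y : ((d.adapted i).background.boost (d.motion i).1 (d.motion i).2).domain |
        y.1 ∈ (fun x ↦ ((d.motion i).1 : E4 ≃L[ℝ] E4) (Θ i (poincareInv (d.motion i).1 (d.motion i).2 x)) +
            (d.motion i).2) ''
          (Subtype.val '' (boostedKerrBackground (d.motion i).1 (d.motion i).2 (M i) (a i)).truncLateRegion τ₁ R)}) := by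
  have hrp : ∀ i, 0 < Kerr.rPlus (M i) (a i) := fun i ↦
    (hsub i).pos.trans_le (le_add_of_nonneg_right (Real.sqrt_nonneg _))
  choose m Rt hmR using fun i ↦ conj_image_truncLateRegion_subset (d.adapted i) (d.motion i).1
    (d.motion i).2 (hrp i) (hr₀ i) (hc i) (hΘc i) (hΘm i) (hΘe i) R
  -- a common old radius and the old separation time
  set Rmax : ℝ := ∑ j, |Rt j| with hRmax
  have hRt : ∀ i, Rt i ≤ Rmax := fun i ↦ (le_abs_self _).trans
    (Finset.single_le_sum (f := fun j ↦ |Rt j|) (fun j _ ↦ abs_nonneg _) (Finset.mem_univ i))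
  obtain ⟨τold, hold⟩ := d.toOver.exists_pairwise_disjoint Rmax
  -- a new time late enough for every hole
  refine ⟨∑ j, |(τold - m j) / c j|, fun i j hij ↦ ?_⟩
  have hτ : ∀ i, τold ≤ c i * (∑ j, |(τold - m j) / c j|) + m i := fun i ↦ by
    have h1 : (τold - m i) / c i ≤ ∑ j, |(τold - m j) / c j| := (le_abs_self _).trans
      (Finset.single_le_sum (f := fun j ↦ |(τold - m j) / c j|) (fun j _ ↦ abs_nonneg _)
        (Finset.mem_univ i))
    have h2 := mul_le_mul_of_nonneg_left h1 (hc i).le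
    rw [mul_div_cancel₀ _ (hc i).ne'] at h2
    linarith
  -- each new tube lies in the old tube of the same hole
  have hincl : ∀ i, d.toOver.chart i ''
      {y : ((d.adapted i).background.boost (d.motion i).1 (d.motion i).2).domain |
        y.1 ∈ (fun x ↦ ((d.motion i).1 : E4 ≃L[ℝ] E4) (Θ i (poincareInv (d.motion i).1 (d.motion i).2 x)) +
            (d.motion i).2) ''
          (Subtype.val '' (boostedKerrBackground (d.motion i).1 (d.motion i).2 (M i) (a i)).truncLateRegion
            (∑ j, |(τold - m j) / c j|) R)} ⊆
      d.toOver.chart i '' ((d.adapted i).background.boost (d.motion i).1 (d.motion i).2).truncLateRegion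
        τold Rmax := fun i ↦ by
    refine image_mono fun y hy ↦ ?_
    have hy' := mem_of_val_mem_image (hmR i _ hy)
    exact ⟨(hτ i).trans_lt hy'.1, hy'.2.trans (hRt i)⟩
  exact (hold hij).mono (hincl i) (hincl j)

/-! ## The re-adapted chart is a late chart, given the tilt inclusion -/

/-- The boosted Kerr–Schild form is nondegenerate on the boosted exterior. [folklore] -/
theorem boostedKerrBilin_nondegenerate (Λ : lorentzGroup) (c₀ : E4) (M a : ℝ) {x : E4}
    (hx : poincareInv Λ c₀ x ∈ (Kerr.exterior M a : Set E4)) (v : E4)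
    (hv : ∀ w, boostedKerrBilin Λ c₀ M a x v w = 0) : v = 0 := by
  have h := Kerr.bilin_nondegenerate M a (Kerr.radius_pos_of_mem_region hx) ((Λ : E4 ≃L[ℝ] E4).symm v)
    fun w ↦ by
      have := hv ((Λ : E4 ≃L[ℝ] E4) w)
      rwa [boostedKerrBilin_apply, ContinuousLinearEquiv.symm_apply_apply] at this
  have h' := congrArg (Λ : E4 ≃L[ℝ] E4) h
  rwa [ContinuousLinearEquiv.apply_symm_apply, map_zero] at h'

/-- **The conjugated identification is an open embedding of the boosted exterior** (isometry clause of
`IsKerrCharted` ⇒ `bilinPullback Φ (moved adapted form) = boostedKerrBilin`, nondegenerate ⇒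
`kerrCharted_isOpenEmbedding`'s mechanism, `isOpenEmbedding_restrict_of_isometry`). [folklore] -/
theorem conj_isOpenEmbedding {𝓑 : StationaryAFBlackHole.{0}} (A : 𝓑.AdaptedChart) (Λ : lorentzGroup)
    (c₀ : E4) {M a r₀ : ℝ} {Θ : E4 → E4} (hr₀ : r₀ ≤ Kerr.rPlus M a)
    (hΘs : ContDiffOn ℝ ∞ Θ (Kerr.region a r₀ : Set E4)) (hinj : InjOn Θ (Kerr.region a r₀ : Set E4))
    (hiso : ∀ z ∈ (Kerr.exterior M a : Set E4), ∀ v w : E4,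
      A.bilin (Θ z) (fderiv ℝ Θ z v) (fderiv ℝ Θ z w) = Kerr.bilin M a z v w) :
    Topology.IsOpenEmbedding (((boostedKerrBackground Λ c₀ M a).domain : Set E4).restrict
      fun x ↦ (Λ : E4 ≃L[ℝ] E4) (Θ (poincareInv Λ c₀ x)) + c₀) := by
  have hsub : (Kerr.exterior M a : Set E4) ⊆ (Kerr.region a r₀ : Set E4) := fun z hz ↦
    Kerr.mem_region.2 ((max_le_max hr₀ le_rfl).trans_lt (Kerr.mem_exterior.1 hz))
  have hS : ((boostedKerrBackground Λ c₀ M a).domain : Set E4) ⊆ poincareInv Λ c₀ ⁻¹' (Kerr.region a r₀ : Set E4) :=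
    fun x hx ↦ hsub (mem_boostedKerrExterior.1 hx)
  have hΦ1 : ContDiffOn ℝ 1 (fun x ↦ (Λ : E4 ≃L[ℝ] E4) (Θ (poincareInv Λ c₀ x)) + c₀)
      ((boostedKerrBackground Λ c₀ M a).domain : Set E4) :=
    ((contDiffOn_conj Λ c₀ hΘs).mono hS).of_le (by exact_mod_cast le_top)
  have hΘd : ∀ z ∈ (Kerr.exterior M a : Set E4), DifferentiableAt ℝ Θ z := fun z hz ↦
    (hΘs.differentiableOn (by simp)).differentiableAt ((Kerr.region a r₀).isOpen.mem_nhds (hsub hz))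
  refine isOpenEmbedding_restrict_of_isometry (boostedKerrBackground Λ c₀ M a).domain.isOpen hΦ1
    (fun x hx x' hx' hxx' ↦ ?_) (A.background.boost Λ c₀).bilin (boostedKerrBilin Λ c₀ M a)
    (fun x hx v w ↦ ?_) (fun x hx v hv ↦ boostedKerrBilin_nondegenerate Λ c₀ M a (mem_boostedKerrExterior.1 hx) v hv)
  · -- injectivity: `P` and `Θ` are injective
    have h1 : Θ (poincareInv Λ c₀ x) = Θ (poincareInv Λ c₀ x') :=
      (Λ : E4 ≃L[ℝ] E4).injective (add_right_cancel hxx')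
    have h2 := hinj (hS hx) (hS hx') h1
    rw [← apply_poincareInv_add Λ c₀ x, ← apply_poincareInv_add Λ c₀ x', h2]
  · have h := bilinPullback_conj_boost_eq_boostedKerrBilin Λ c₀ A hΘd hiso (mem_boostedKerrExterior.1 hx)
    have h' := DFunLike.congr_fun (DFunLike.congr_fun h v) w
    rw [bilinPullback_apply] at h'
    exact h'

/-- **Re-adapting a late chart along a map of model domains gives a late chart** — given the TILT
INCLUSION `Φ̂(late₂) ⊆ late₁` (which the typed clauses of `IsKerrCharted` do NOT provide, see the
worker's report): smoothness composes (`contMDiff_readapt`), the restriction of the open embedding `Φ̂`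
to the open late region stays an open embedding and composes with `ψ|late₁`, and the image clause is a
hypothesis (formal for `O' = exteriorOf …` by `subset_exteriorOf_of_isOpen`). [folklore] -/
theorem isLateChart_readapt (𝓢 : Spacetime.{0} 4) (B₁ B₂ : ModelBackground) {O O' : Set 𝓢.carrier}
    {τ₀ τ₀' : ℝ} {ψ : B₁.domain → 𝓢.carrier} (hψ : 𝓢.IsLateChart B₁ O τ₀ ψ) {Φ : E4 → E4}
    (hΦ : ContDiffOn ℝ ∞ Φ (B₂.domain : Set E4)) (hmaps : MapsTo Φ (B₂.domain : Set E4) (B₁.domain : Set E4))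
    (hemb : Topology.IsOpenEmbedding ((B₂.domain : Set E4).restrict Φ))
    (hL₂ : IsOpen (B₂.lateRegion τ₀'))
    (hlate : MapsTo (fun y : B₂.domain ↦ (⟨Φ y.1, hmaps y.2⟩ : B₁.domain)) (B₂.lateRegion τ₀')
      (B₁.lateRegion τ₀))
    (himg : (fun y : B₂.domain ↦ ψ ⟨Φ y.1, hmaps y.2⟩) '' B₂.lateRegion τ₀' ⊆ O') :
    𝓢.IsLateChart B₂ O' τ₀' (fun y ↦ ψ ⟨Φ y.1, hmaps y.2⟩) where
  contMDiff := hψ.contMDiff.comp (contMDiff_readapt hmaps hΦ)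
  isOpenEmbedding := by
    have hΦ' : Topology.IsOpenEmbedding (fun y : B₂.domain ↦ (⟨Φ y.1, hmaps y.2⟩ : B₁.domain)) :=
      Topology.IsOpenEmbedding.of_comp _ B₁.domain.isOpen.isOpenEmbedding_subtypeVal hemb
    exact hψ.isOpenEmbedding.comp (hΦ'.restrict hlate hL₂)
  image_subset := himg

/-- The late regions of the boosted Kerr background are open (its time `(P⁻¹ x)⁰` is continuous). [folklore] -/
theorem isOpen_lateRegion_boostedKerr (Λ : lorentzGroup) (c₀ : E4) (M a τ : ℝ) :
    IsOpen ((boostedKerrBackground Λ c₀ M a).lateRegion τ) :=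
  isOpen_lt continuous_const ((continuous_movedTime Λ c₀).comp continuous_subtype_val)

/-- **The re-adapted hole chart of the transfer is a late chart**, given the tilt inclusion
`t* ∘ P⁻¹ > τ₀' ⇒ x⁰ ∘ P⁻¹ ∘ Φ > τ₀` on the boosted exterior and the image clause. [folklore] -/
theorem isLateChart_conj (𝓢 : Spacetime.{0} 4) {𝓑 : StationaryAFBlackHole.{0}} (A : 𝓑.AdaptedChart)
    (Λ : lorentzGroup) (c₀ : E4) {M a r₀ : ℝ} {Θ : E4 → E4} {O O' : Set 𝓢.carrier} {τ₀ τ₀' : ℝ}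
    {ψ : (A.background.boost Λ c₀).domain → 𝓢.carrier}
    (hψ : 𝓢.IsLateChart (A.background.boost Λ c₀) O τ₀ ψ) (hr₀ : r₀ ≤ Kerr.rPlus M a)
    (hΘs : ContDiffOn ℝ ∞ Θ (Kerr.region a r₀ : Set E4)) (hinj : InjOn Θ (Kerr.region a r₀ : Set E4))
    (hiso : ∀ z ∈ (Kerr.exterior M a : Set E4), ∀ v w : E4,
      A.bilin (Θ z) (fderiv ℝ Θ z v) (fderiv ℝ Θ z w) = Kerr.bilin M a z v w)
    (hmaps : MapsTo (fun x ↦ (Λ : E4 ≃L[ℝ] E4) (Θ (poincareInv Λ c₀ x)) + c₀)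
      ((boostedKerrBackground Λ c₀ M a).domain : Set E4) ((A.background.boost Λ c₀).domain : Set E4))
    (htilt : ∀ x ∈ ((boostedKerrBackground Λ c₀ M a).domain : Set E4), τ₀' < (poincareInv Λ c₀ x) 0 →
      τ₀ < (poincareInv Λ c₀ ((Λ : E4 ≃L[ℝ] E4) (Θ (poincareInv Λ c₀ x)) + c₀)) 0)
    (himg : (fun y : (boostedKerrBackground Λ c₀ M a).domain ↦
      ψ ⟨(Λ : E4 ≃L[ℝ] E4) (Θ (poincareInv Λ c₀ y.1)) + c₀, hmaps y.2⟩) ''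
        (boostedKerrBackground Λ c₀ M a).lateRegion τ₀' ⊆ O') :
    𝓢.IsLateChart (boostedKerrBackground Λ c₀ M a) O' τ₀'
      (fun y ↦ ψ ⟨(Λ : E4 ≃L[ℝ] E4) (Θ (poincareInv Λ c₀ y.1)) + c₀, hmaps y.2⟩) := by
  have hsub : (Kerr.exterior M a : Set E4) ⊆ (Kerr.region a r₀ : Set E4) := fun z hz ↦
    Kerr.mem_region.2 ((max_le_max hr₀ le_rfl).trans_lt (Kerr.mem_exterior.1 hz))
  have hS : ((boostedKerrBackground Λ c₀ M a).domain : Set E4) ⊆ poincareInv Λ c₀ ⁻¹' (Kerr.region a r₀ : Set E4) :=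
    fun x hx ↦ hsub (mem_boostedKerrExterior.1 hx)
  exact isLateChart_readapt 𝓢 _ _ hψ ((contDiffOn_conj Λ c₀ hΘs).mono hS) hmaps
    (conj_isOpenEmbedding A Λ c₀ hr₀ hΘs hinj hiso) (isOpen_lateRegion_boostedKerr Λ c₀ M a τ₀')
    (fun y hy ↦ htilt y.1 y.2 hy) himg

/-- **Registered helper `nearZone_transfer`** (binder-free form of `tendsto_truncDeviationCk_readapt`):
the near-zone clause `tendsto_truncDeviationCk` of the Kerr–Schild decomposition produced by
`stub_chartTransfer`, hole by hole, from the clauses of the stationary decomposition and of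
`IsKerrCharted`. [folklore] -/
theorem nearZone_transfer : ∀ (𝓢 : Spacetime.{0} 4) (𝓑 : StationaryAFBlackHole.{0}) (A : 𝓑.AdaptedChart) (Λ : lorentzGroup) (c₀ : E4) (M a c r₀ : ℝ) (Θ : E4 → E4) (k : ℕ) (ψ : (A.background.boost Λ c₀).domain → 𝓢.carrier) (hmaps : Set.MapsTo (fun x ↦ (Λ : E4 ≃L[ℝ] E4) (Θ (poincareInv Λ c₀ x)) + c₀) ((boostedKerrBackground Λ c₀ M a).domain : Set E4) ((A.background.boost Λ c₀).domain : Set E4)), ContMDiff 𝓘(ℝ, E4) (𝓡 4) ∞ ψ → Kerr.IsSubextremal M a → 0 < c → r₀ < Kerr.rPlus M a → ContDiffOn ℝ ∞ Θ (Kerr.region a r₀ : Set E4) → Set.MapsTo Θ (Kerr.region a r₀ : Set E4) (A.domain : Set E4) → (∀ x ∈ (Kerr.region a r₀ : Set E4), ∀ s : ℝ, Θ (x + s • E4.basisVector 0) = Θ x + (c * s) • E4.basisVector 0) → (∀ z ∈ (Kerr.exterior M a : Set E4), ∀ v w : E4, A.bilin (Θ z) (fderiv ℝ Θ z v) (fderiv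 ℝ Θ z w) = Kerr.bilin M a z v w) → (∀ Rt : ℝ, Filter.Tendsto (fun σ ↦ 𝓢.truncDeviationCk (A.background.boost Λ c₀) ψ k Rt σ) Filter.atTop (nhds 0)) → ∀ R : ℝ, Filter.Tendsto (fun τ ↦ 𝓢.truncDeviationCk (boostedKerrBackground Λ c₀ M a) (fun y ↦ ψ ⟨(Λ : E4 ≃L[ℝ] E4) (Θ (poincareInv Λ c₀ y.1)) + c₀, hmaps y.2⟩) k R τ) Filter.atTop (nhds 0) :=
  fun 𝓢 _ A Λ c₀ _ _ _ _ _ _ _ hmaps hψ hsub hc hr₀ hΘs hΘm hΘe hiso hdev R ↦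
    tendsto_truncDeviationCk_readapt 𝓢 A Λ c₀ hψ hsub hc hr₀ hΘs hΘm hΘe hiso hmaps hdev R

end Summit.FinalStateConjecture.FinalStateConjecture.Theorems.SymplecticDualOfTheBomb

end
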